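import Summits.BirchSwinnertonDyer.BirchSwinnertonDyer.Theorems.ThetaPartnerAtTwoSignedKatoUpToAtTwoFlatSelmerPlus
import Summits.BirchSwinnertonDyer.BirchSwinnertonDyer.Theorems.ByReductionTypeAtTwoOrdIsogenyDualMaps
import Literature.NumberTheory.EllipticCurves.Sprung2012.SharpFlatSelmerDualExistsProofs
import Literature.NumberTheory.EllipticCurves.Kobayashi2003.SignedSelmerDualUniquenessProofs
import Literature.NumberTheory.EllipticCurves.IwasawaAlgebraDivisibilityProofs
import Mathlib.Algebra.Module.CharacterModule
import HarnessLib

/-!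
# Route `ThetaPartnerAtTwo` (TP2), crux K3 `SignedKatoDivisibilityUpToAtTwo` (item stmt-BirchSwinnertonDyer-20308),
# line `colemanrat` v3 — file 18: **`X♭(E/K_∞) ↠ X⁺(E/K_∞)` at `a_p = 0`** — the Pontryagin dual of file 17's inclusion
# `Sel⁺ ≤ Sel♭` ON THE PINNED DUAL DATA: a `Λ`-LINEAR SURJECTION from ANY `Sprung2012.SharpFlatSelmerDualData` (♭) onto ANY
# `Kobayashi2003.SignedSelmerDualData` (sign `+`, K3's `D`), hence `ℓ_𝔭(X⁺) ≤ ℓ_𝔭(X♭)` at every prime `𝔭` of `Λ` and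
# `X⁺` is `Λ`-torsion when `X♭` is: the ♭-Kato divisibility at `2` bounds K3's `X⁺`

HONEST FRAMING (cell `bsd-wall`, width seat `bsd-wall-tp2-p2x-w2` g2): THEOREMS ONLY — no definition, no named fact, no instance,
no `sorry`; the Honda clauses / local lift are DISPLAYED HYPOTHESES (HONDA⁺@2); closes no item; BSD is NOT proved by any of this.

## Why this file

K3 is consumed in LENGTH form (`…OffTwoRoad`: `ℓ_𝔭(X⁺) + … ≤ …`) on a pinned `D : SignedSelmerDualData W κ γ 1`. File 17 gives
`Sel⁺(E/K_∞) ≤ Sel♭(E/K_∞)` (Kobayashi ≤ Sprung at `a_p = 0`). Dualising on the pinned interfaces — exactly as width seat `w3`'s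
`…FineRestriction` dualises `Sel₀ ≤ Sel^ε` — gives a `Λ`-linear `r : D♭.X → D.X` with `D.toDual (r x) = D♭.toDual x ∘ ιP`, ONTO
(`ℚ/ℤ` divisible: `CharacterModule.dual_surjective_of_injective`); `Λ`-linearity because both `Λ`-actions read through `toDual` are
the canonical ones (`SignedSelmerDualData.toDual_smul`; §1 the ♭ copy) which are natural along `ιP` (`IsLocNil.smulFun_comp`). So
`ℓ_𝔭(D.X) ≤ ℓ_𝔭(D♭.X)` for every prime `𝔭` of `Λ`: any upper bound for the ♭ dual (the currency of the `bsd-2adic` cell's Col♭ road,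
crux 19097) bounds K3's `X⁺`.

## What is proved (`Λ = IwasawaAlgebra p`; number field `K`, `κ`, `γ`; Sprung data `(ι, 0, g, d, ♭)`)

* §1 `sharpFlatDual_toDual_smul` — the `Λ`-action of ANY `SharpFlatSelmerDualData` read through `toDual` is `IsLocNil.smulFun` of
  `conj_γ − 1` (♭ copy of `SignedSelmerDualData.toDual_smul`).
* §2 `exists_flatToPlusRestrict` — given `Sel⁺ ≤ Sel♭` (hypothesis `hle`, e.g. file 17), **∃ `Λ`-linear `r : D♭.X → D.X` with
  `D.toDual (r x) s = D♭.toDual x (ιP s)`**; `flatToPlusRestrict_surjective` (ONTO); `lengthAt_plus_le_lengthAt_flat`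
  (**`ℓ_𝔭(D.X) ≤ ℓ_𝔭(D♭.X)`**); `isTorsion_plus_of_isTorsion_flat`.
* §3 `lengthAt_signed_le_lengthAt_sharpFlat_two` — at `p = 2`, `W/ℚ` globally minimal with `GoodSS W 2`, `κ` cyclotomic, `v ∋ 2`, for
  a Honda system `d` of `a_p = 0` shape (HONDA⁺@2) and a local lift `g`: `ℓ_𝔭(D.X) ≤ ℓ_𝔭(D♭.X)` for every `D : SignedSelmerDualData W κ γ 1`
  (K3's datum) and every `D♭ : SharpFlatSelmerDualData W κ γ (closureEmb ℚ_v) 0 g d .flat`, every `𝔭`.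

References: [Kobayashi2003] S. Kobayashi, Invent. Math. 152 (2003), Def. 1.1, (7.21); [Sprung2012] F. Sprung, J. Number Theory 132
(2012), Def. 7.11, Thm. 7.14; [GreenbergLNM1716] §1 (p. 60); [Washington1997] §13.2.
-/

set_option autoImplicit false
-- the Theorems namespace of this sub repeats the summit name by design (D-0017 nested layout)
set_option linter.dupNamespace false

noncomputable section

open scoped Classical NumberField

universe u

namespace Summit.BirchSwinnertonDyer.BirchSwinnertonDyer.Theorems

namespace SignedKatoOffTwo.FlatKernel

open NumberField IsDedekindDomain WeierstrassCurve Literature.NumberTheory.EllipticCurves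
  Literature.NumberTheory.EllipticCurves.Kobayashi2003 Literature.NumberTheory.EllipticCurves.Sprung2017
  Literature.NumberTheory.EllipticCurves.Sprung2012 Literature.NumberTheory.EllipticCurves.IwasawaDual
  Literature.NumberTheory.EllipticCurves.Module Literature.NumberTheory.GaloisRepresentations
  Literature.NumberTheory.EllipticCurves.Rank1Residual ZpExtension
  Summit.BirchSwinnertonDyer.BirchSwinnertonDyer.Theorems.IsogenyMuShift

section General

variable {K : Type u} [Field K] [NumberField K] (W : WeierstrassCurve K) {p : ℕ} [Fact p.Prime]
  (κ : ZpExtension K p) {γ : Field.absoluteGaloisGroup K}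
  {E : Type u} [Field E] [Algebra K E] (ι : AlgebraicClosure K →ₐ[K] AlgebraicClosure E)
  (g : Field.absoluteGaloisGroup E) (d : ℕ → localPoints W E)

/-! ## §1 The `Λ`-action of a `SharpFlatSelmerDualData` is forced -/

/-- Induction carrier for `sharpFlatDual_toDual_smul` (♭ copy of `SignedSelmerDualData.toDual_smul_apply_of_pow_apply_eq_zero`).
[cite: GreenbergLNM1716, §1 (p. 60)] [cite: Sprung2012, Def. 7.11 (p. 1503)] -/
theorem sharpFlatDual_toDual_smul_apply_of_pow_apply_eq_zero
    (Y : SharpFlatSelmerDualData W κ γ ι 0 g d .flat) (N : ℕ) :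
    ∀ (s : sharpFlatSelmerInfty W κ ι 0 g d .flat),
      ((conjSharpFlatSelmerInfty W κ ι 0 g d .flat γ - 1) ^ N) s = 0 →
      ∀ (f : IwasawaAlgebra p) (x : Y.X),
        Y.toDual (f • x) s =
          (isLocNil_conjSharpFlatSelmerInfty_sub_one' W κ ι 0 g d .flat γ).smulFun f (Y.toDual x) s := by
  set h := isLocNil_conjSharpFlatSelmerInfty_sub_one' W κ ι 0 g d .flat γ
  set ψ : AddMonoid.End (sharpFlatSelmerInfty W κ ι 0 g d .flat) :=
    conjSharpFlatSelmerInfty W κ ι 0 g d .flat γ - 1 with hψ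
  induction N with
  | zero =>
    intro s hs f x
    rw [pow_zero, AddMonoid.End.one_apply] at hs
    rw [hs, map_zero, map_zero]
  | succ N ih =>
    intro s hs f x
    obtain ⟨k, hk⟩ := h.torsion s
    have hψs : (ψ ^ N) (ψ s) = 0 := by
      rwa [pow_succ, AddMonoid.End.coe_mul, Function.comp_apply] at hs
    have hψeval : ∀ y : Y.X, Y.toDual y (ψ s) =
        Y.toDual y ⟨W.conjH1 p κ.kerSubgroup γ s, Y.conj_mem s s.2⟩ - Y.toDual y s :=
      fun y ↦ by
        rw [hψ, IwasawaDual.End_sub_apply, AddMonoid.End.one_apply, map_sub]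
        rfl
    set g' : IwasawaAlgebra p := PowerSeries.mk fun n ↦ PowerSeries.coeff (n + 1) f
    set a : ℤ_[p] := PowerSeries.constantCoeff f
    have hf : f = PowerSeries.X * g' + PowerSeries.C a := PowerSeries.eq_X_mul_shift_add_const f
    have lhs : Y.toDual (f • x) s =
        Y.toDual (g' • x) (ψ s) + (PadicInt.toZModPow k a).val • Y.toDual x s := by
      conv_lhs => rw [hf]
      rw [add_smul, mul_smul, map_add, AddMonoidHom.add_apply, Y.toDual_T_smul,
        Y.toDual_C_smul a x s k hk, hψeval]
    have rhs : h.smulFun f (Y.toDual x) s =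
        h.smulFun g' (Y.toDual x) (ψ s) + (PadicInt.toZModPow k a).val • Y.toDual x s := by
      conv_lhs => rw [hf]
      rw [h.smulFun_add_left, h.smulFun_mul_left, AddMonoidHom.add_apply, h.smulFun_X_apply,
        h.smulFun_C_apply a (Y.toDual x) hk]
    rw [lhs, rhs, ih (ψ s) hψs g' x]

/-- **The `Λ`-action of a `SharpFlatSelmerDualData` is forced**: `Y.toDual (f • x) = f ⋆ Y.toDual x` with `⋆` the canonical action
attached to `conj_γ − 1` on `Hom(Sel♭_∞, ℚ/ℤ)` (`isLocNil_conjSharpFlatSelmerInfty_sub_one'`). [cite: GreenbergLNM1716, §1 (p. 60)]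
[cite: Sprung2012, Def. 7.11 (p. 1503)] -/
theorem sharpFlatDual_toDual_smul (Y : SharpFlatSelmerDualData W κ γ ι 0 g d .flat) (f : IwasawaAlgebra p) (x : Y.X) :
    Y.toDual (f • x) = (isLocNil_conjSharpFlatSelmerInfty_sub_one' W κ ι 0 g d .flat γ).smulFun f (Y.toDual x) := by
  ext s
  obtain ⟨N, hN⟩ := (isLocNil_conjSharpFlatSelmerInfty_sub_one' W κ ι 0 g d .flat γ).nil s
  exact sharpFlatDual_toDual_smul_apply_of_pow_apply_eq_zero W κ ι g d Y N s hN f x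

/-! ## §2 The restriction `r : X♭ ↠ X⁺` dual to an inclusion `Sel⁺ ≤ Sel♭` -/

/-- An inclusion `Sel⁺_∞ ≤ Sel♭_∞` intertwines `conj_γ − 1` on the two groups (both restrictions of `conj_γ` on `H¹(K_∞, E[p^∞])`).
[cite: Kobayashi2003, Def. 1.1 (p. 2)] [cite: Sprung2012, Def. 7.11 (p. 1503)] -/
theorem inclusion_conjSignedSelmerInfty_sub_one (hle : signedSelmerInfty W κ 1 ≤ sharpFlatSelmerInfty W κ ι 0 g d .flat)
    (γ : Field.absoluteGaloisGroup K) (s : signedSelmerInfty W κ 1) :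
    AddSubgroup.inclusion hle ((conjSignedSelmerInfty W κ 1 γ - 1) s) =
      (conjSharpFlatSelmerInfty W κ ι 0 g d .flat γ - 1) (AddSubgroup.inclusion hle s) := by
  rw [IwasawaDual.End_sub_apply, IwasawaDual.End_sub_apply, AddMonoid.End.one_apply, AddMonoid.End.one_apply, map_sub]
  exact congrArg (· - _) (Subtype.ext rfl)

/-- **The restriction `r : X♭ → X⁺` exists and is `Λ`-linear** on the pinned duals, given an inclusion `Sel⁺_∞ ≤ Sel♭_∞`:
`D.toDual (r x) s = D♭.toDual x (ιP s)`. [cite: Kobayashi2003, (7.21) (p. 13)] [cite: Sprung2012, Def. 7.11 (p. 1503)]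
[cite: GreenbergLNM1716, §1 (p. 60)] -/
theorem exists_flatToPlusRestrict (hle : signedSelmerInfty W κ 1 ≤ sharpFlatSelmerInfty W κ ι 0 g d .flat)
    (Df : SharpFlatSelmerDualData W κ γ ι 0 g d .flat) (D : SignedSelmerDualData W κ γ 1) :
    ∃ r : Df.X →ₗ[IwasawaAlgebra p] D.X, ∀ (x : Df.X) (s : signedSelmerInfty W κ 1),
      D.toDual (r x) s = Df.toDual x (AddSubgroup.inclusion hle s) := by
  set ιP : signedSelmerInfty W κ 1 →+ sharpFlatSelmerInfty W κ ι 0 g d .flat := AddSubgroup.inclusion hle with hιP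
  set eD := AddEquiv.ofBijective D.toDual D.bijective with heD
  have heD_apply : ∀ χ, D.toDual (eD.symm χ) = χ := fun χ ↦ eD.apply_symm_apply χ
  refine ⟨{ toFun := fun x ↦ eD.symm ((Df.toDual x).comp ιP)
            map_add' := fun x y ↦ by rw [map_add, AddMonoidHom.add_comp, map_add]
            map_smul' := fun f x ↦ ?_ }, fun x s ↦ ?_⟩
  · apply D.bijective.injective
    rw [RingHom.id_apply, heD_apply, D.toDual_smul, heD_apply, sharpFlatDual_toDual_smul W κ ι g d Df,
      IsLocNil.smulFun_comp (isLocNil_conjSignedSelmerInfty_sub_one' W κ 1 γ)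
        (isLocNil_conjSharpFlatSelmerInfty_sub_one' W κ ι 0 g d .flat γ) ιP
        (fun s ↦ inclusion_conjSignedSelmerInfty_sub_one W κ ι g d hle γ s)]
  · show D.toDual (eD.symm ((Df.toDual x).comp ιP)) s = _
    rw [heD_apply, AddMonoidHom.comp_apply]

/-- **`r : X♭ ↠ X⁺` is ONTO**: every character of `Sel⁺_∞` extends to `Sel♭_∞` (`ℚ/ℤ` divisible; Baer).
[cite: Kobayashi2003, (7.21) (p. 13)] [cite: Sprung2012, Def. 7.11 (p. 1503)] -/
theorem flatToPlusRestrict_surjective (hle : signedSelmerInfty W κ 1 ≤ sharpFlatSelmerInfty W κ ι 0 g d .flat)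
    (Df : SharpFlatSelmerDualData W κ γ ι 0 g d .flat) (D : SignedSelmerDualData W κ γ 1)
    (r : Df.X →ₗ[IwasawaAlgebra p] D.X)
    (hr : ∀ (x : Df.X) (s : signedSelmerInfty W κ 1), D.toDual (r x) s = Df.toDual x (AddSubgroup.inclusion hle s)) :
    Function.Surjective r := by
  intro y
  set ιP : signedSelmerInfty W κ 1 →+ sharpFlatSelmerInfty W κ ι 0 g d .flat := AddSubgroup.inclusion hle with hιP
  have hinj : Function.Injective ιP.toIntLinearMap := AddSubgroup.inclusion_injective hle
  obtain ⟨L, hL⟩ := CharacterModule.dual_surjective_of_injective (R := ℤ) ιP.toIntLinearMap hinj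
    (D.toDual y : CharacterModule (signedSelmerInfty W κ 1))
  obtain ⟨x, hx⟩ := Df.bijective.surjective (L : sharpFlatSelmerInfty W κ ι 0 g d .flat →+ AddCircle (1 : ℚ))
  refine ⟨x, D.bijective.injective (AddMonoidHom.ext fun s ↦ ?_)⟩
  rw [hr, hx]
  have := congrArg (fun χ : CharacterModule (signedSelmerInfty W κ 1) ↦ χ s) hL
  simp only [CharacterModule.dual_apply] at this
  exact this

/-- **`ℓ_𝔭(X⁺) ≤ ℓ_𝔭(X♭)` at every prime `𝔭` of `Λ`**, for any pinned ♭ datum `Df` and any pinned K3 datum `D`, given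
`Sel⁺_∞ ≤ Sel♭_∞` (the restriction is onto). [cite: Kobayashi2003, (7.21) (p. 13)] [cite: Sprung2012, Thm. 7.14 (p. 1504)] -/
theorem lengthAt_plus_le_lengthAt_flat (hle : signedSelmerInfty W κ 1 ≤ sharpFlatSelmerInfty W κ ι 0 g d .flat)
    (Df : SharpFlatSelmerDualData W κ γ ι 0 g d .flat) (D : SignedSelmerDualData W κ γ 1)
    (𝔭 : PrimeSpectrum (IwasawaAlgebra p)) :
    lengthAt (IwasawaAlgebra p) D.X 𝔭 ≤ lengthAt (IwasawaAlgebra p) Df.X 𝔭 := by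
  obtain ⟨r, hr⟩ := exists_flatToPlusRestrict W κ ι g d hle Df D
  exact lengthAt_le_of_surjective r (flatToPlusRestrict_surjective W κ ι g d hle Df D r hr) 𝔭

/-- **`X⁺` is `Λ`-torsion whenever `X♭` is** (image of a torsion module under the onto `Λ`-linear `r`).
[cite: Sprung2012, Thm. 7.14 (p. 1504)] [cite: Kobayashi2003, Thm. 1.2] -/
theorem isTorsion_plus_of_isTorsion_flat (hle : signedSelmerInfty W κ 1 ≤ sharpFlatSelmerInfty W κ ι 0 g d .flat)
    (Df : SharpFlatSelmerDualData W κ γ ι 0 g d .flat) (D : SignedSelmerDualData W κ γ 1)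
    (hDf : Module.IsTorsion (IwasawaAlgebra p) Df.X) : Module.IsTorsion (IwasawaAlgebra p) D.X := by
  obtain ⟨r, hr⟩ := exists_flatToPlusRestrict W κ ι g d hle Df D
  intro y
  obtain ⟨x, rfl⟩ := flatToPlusRestrict_surjective W κ ι g d hle Df D r hr y
  obtain ⟨a, ha⟩ := @hDf x
  have ha' : (a : IwasawaAlgebra p) • x = 0 := ha
  exact ⟨a, show (a : IwasawaAlgebra p) • r x = 0 by rw [← map_smul, ha', map_zero]⟩

end General

/-! ## §3 `p = 2` on the theta habitat: `ℓ_𝔭(X⁺) ≤ ℓ_𝔭(X♭)` modulo HONDA⁺@2 -/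

/-- **`ℓ_𝔭(X⁺(E/ℚ_∞)) ≤ ℓ_𝔭(X♭(E/ℚ_∞))` AT `p = 2`, modulo HONDA⁺@2**: for `W/ℚ` globally minimal with `GoodSS W 2`, the cyclotomic
`κ`, any `γ`, the place `v ∋ 2`, a local lift `g` of the topological generator and a plus Honda system `d` at `2` ((L) (TR) (GEN)
(GEN₀), the body of K4's `stub_plusHondaSystemTwo` at (`W`, `κ`, `v`)): for EVERY pinned `D : SignedSelmerDualData W κ γ 1` (K3's
datum) and every pinned ♭ datum `Df`, at every prime `𝔭` of `Λ`. Any ♭-side length bound at `2` (the `bsd-2adic` cell's Col♭ road)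
therefore bounds K3's `X⁺`. [cite: Kobayashi2003, Def. 1.1, (7.21)] [cite: Sprung2012, Def. 7.11, Thm. 7.14] [cite: KuriharaOtsuki2006, p. 557] -/
theorem lengthAt_signed_le_lengthAt_sharpFlat_two (W : WeierstrassCurve ℚ) [W.IsElliptic] [W.IsGloballyMinimal]
    (hss : GoodSS W 2) {κ : ZpExtension ℚ 2} (hκ : κ.IsCyclotomic) {γ : Field.absoluteGaloisGroup ℚ}
    (v : HeightOneSpectrum (𝓞 ℚ)) (hv : (2 : 𝓞 ℚ) ∈ v.asIdeal)
    {g : Field.absoluteGaloisGroup (v.adicCompletion ℚ)}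
    (hg : κ.IsTopGenerator (resGalOfEmb (closureEmb (K := ℚ) (v.adicCompletion ℚ)) g))
    {d : ℕ → localPoints W (v.adicCompletion ℚ)}
    (hd : ∀ m, d m ∈ localLayerPoints κ (v.adicCompletion ℚ) W m)
    (htr : ∀ m, localTrace κ (v.adicCompletion ℚ) W (m + 1) (m + 2) (d (m + 2)) = -d m)
    (hgen : ∀ m : ℕ, 1 ≤ m → ∀ P ∈ localLayerPoints κ (v.adicCompletion ℚ) W m,
      ∃ B ∈ AddSubgroup.closure (Set.range fun σ : Field.absoluteGaloisGroup (v.adicCompletion ℚ) ↦ σ • d m),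
        ∃ P' ∈ localLayerPoints κ (v.adicCompletion ℚ) W (m - 1),
          ∃ R ∈ localLayerPoints κ (v.adicCompletion ℚ) W m, P = B + P' + 2 • R)
    (hgen0 : ∀ P ∈ localLayerPoints κ (v.adicCompletion ℚ) W 0,
      ∃ a : ℤ, ∃ R ∈ localLayerPoints κ (v.adicCompletion ℚ) W 0, P = a • d 0 + 2 • R)
    (D : SignedSelmerDualData W κ γ 1)
    (Df : SharpFlatSelmerDualData W κ γ (closureEmb (K := ℚ) (v.adicCompletion ℚ)) 0 g d .flat)
    (𝔭 : PrimeSpectrum (IwasawaAlgebra 2)) :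
    lengthAt (IwasawaAlgebra 2) D.X 𝔭 ≤ lengthAt (IwasawaAlgebra 2) Df.X 𝔭 :=
  lengthAt_plus_le_lengthAt_flat W κ (closureEmb (K := ℚ) (v.adicCompletion ℚ)) g d
    (signedSelmerInfty_le_sharpFlatSelmerInfty_flat_two W hss hκ v hv hg hd htr hgen hgen0) Df D 𝔭

end SignedKatoOffTwo.FlatKernel

end Summit.BirchSwinnertonDyer.BirchSwinnertonDyer.Theorems

end
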